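import Mathlib
import Literature.AlgebraicGeometry.Resolution.AffineDomainDimension
import HarnessLib

/-!
# Lemma L1 of line `via-clean-models` (crux stmt-ResolutionOfSingularities-15917 `RadicialJung.CleanModels`), part 1:
# monogenic presentations `B = O[y] ≅ O[Y]/(Y^p - s)` and the COTANGENT COUNT

Pure commutative algebra used by `RadicialJungCleanModelsL1OfKunzConjecture.lean` (lemma L1 = pointwise converse of
`RadicialJung.CleanResolves`: a regular degree-`p` height-one radicial normalisation over a regular local ring is clean,
modulo Kunz's conjecture = Kimura–Niitsuma 1982).  Line card `Cruxes/DescentPerfectToAll/Lines/via-clean-models.md`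
rev 2c, stub plan P0; lead `res-B-lead-1` g0, 2026-08-28.

* `aeval_surjective_and_ker_eq_of_linearIndependent_pow` — if `B = O[γ]`, `γ^p = s ∈ O` and `1, γ, …, γ^{p-1}` are
  `O`-linearly independent, then `Y ↦ γ` is a surjection `O[Y] → B` with kernel `(Y^p - s)`;
* `presentation_shift` — in characteristic `p` the presentation survives `γ ↦ γ - c`, `s ↦ s - c^p` (`c ∈ O`);
* `not_mem_sq_of_presentation` — **the cotangent count**: for regular local `O ⊆ B`, `B` finite over `O` along a local
  homomorphism, `B ≅ O[Y]/(Y^p - s)` via `Y ↦ y ∈ 𝔪_B` forces `s ∉ 𝔪_O²` (lift a `κ_O`-basis `x₁, …, x_d` of `𝔪_O/𝔪_O²`,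
  `d = dim O = dim B`; a `κ_B`-relation among the classes of `x₁, …, x_d, y` in `𝔪_B/𝔪_B²`, read in `O[Y]` modulo
  `(𝔪_O O[Y] + (Y))² + (Y^p - s)`, has `Y⁰`-coefficient in `𝔪_O²` and `Y¹`-coefficient in `𝔪_O`, so it is trivial;
  `d + 1` independent classes contradict `dim_{κ_B} 𝔪_B/𝔪_B² = dim B = d`).

Nothing here is a statement of H. Hironaka's 2017 manuscript; `RadicialJung.CleanModels` (stmt-15917) remains OPEN in
`dim ≥ 3`.
-/

noncomputable section

set_option linter.dupNamespace false

open IsLocalRing Polynomial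

namespace Summit.ResolutionOfSingularities.ResolutionOfSingularities.Theorems.RadicialJung.CleanModels

/-! ## Monogenic presentations `B = O[γ] ≅ O[Y]/(Y^p - s)` -/

section Presentation

variable {O B : Type*} [CommRing O] [Nontrivial O] [CommRing B] [Algebra O B]

/-- If `B = O[γ]`, `γ^p = s ∈ O` and `1, γ, …, γ^{p-1}` are linearly independent over `O`, then `Y ↦ γ` is a
SURJECTION `O[Y] → B` with kernel exactly `(Y^p - s)`. [folklore] -/
theorem aeval_surjective_and_ker_eq_of_linearIndependent_pow {p : ℕ} (hp : 0 < p) (γ : B) (s : O)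
    (hγs : algebraMap O B s = γ ^ p) (hadj : Algebra.adjoin O {γ} = ⊤)
    (hli : LinearIndependent O (fun i : Fin p => γ ^ (i : ℕ))) :
    Function.Surjective (aeval γ : O[X] →ₐ[O] B) ∧
      RingHom.ker (aeval γ : O[X] →ₐ[O] B) = Ideal.span {X ^ p - C s} := by
  have hsurj : Function.Surjective (aeval γ : O[X] →ₐ[O] B) := by
    rw [← AlgHom.range_eq_top, ← Algebra.adjoin_singleton_eq_range_aeval, hadj]
  refine ⟨hsurj, ?_⟩
  have hmonic : (X ^ p - C s : O[X]).Monic := monic_X_pow_sub_C s hp.ne'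
  have hroot : aeval γ (X ^ p - C s : O[X]) = 0 := by
    simp [hγs]
  apply le_antisymm
  · intro g hg
    rw [RingHom.mem_ker] at hg
    rw [Ideal.mem_span_singleton, ← Polynomial.modByMonic_eq_zero_iff_dvd hmonic]
    set r := g %ₘ (X ^ p - C s) with hr
    have hdeg : r.natDegree < p := by
      have h := Polynomial.natDegree_modByMonic_lt g hmonic (by
        intro h1
        have := congrArg Polynomial.natDegree h1
        rw [natDegree_X_pow_sub_C, natDegree_one] at this
        omega)
      rwa [natDegree_X_pow_sub_C] at h
    have hr0 : aeval γ r = 0 := by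
      rw [hr, Polynomial.aeval_modByMonic_eq_self_of_root hroot]
      exact hg
    rw [Polynomial.aeval_eq_sum_range' hdeg, Finset.sum_range] at hr0
    have hcoeff : ∀ i : Fin p, r.coeff i = 0 := Fintype.linearIndependent_iff.mp hli _ hr0
    ext n
    rw [coeff_zero]
    by_cases hn : n < p
    · exact hcoeff ⟨n, hn⟩
    · exact Polynomial.coeff_eq_zero_of_natDegree_lt (lt_of_lt_of_le hdeg (not_lt.mp hn))
  · rw [Ideal.span_le, Set.singleton_subset_iff, SetLike.mem_coe, RingHom.mem_ker]
    exact hroot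

omit [Nontrivial O] in
/-- SHIFT: if `Y ↦ γ` presents `B` as `O[Y]/(Y^p - s)` and `p` is the characteristic, then for `c ∈ O` the element
`γ - c` presents `B` as `O[Y]/(Y^p - (s - c^p))`. [folklore] -/
theorem presentation_shift {p : ℕ} [hp : Fact p.Prime] [CharP O p] (γ : B) (s : O)
    (hsurj : Function.Surjective (aeval γ : O[X] →ₐ[O] B))
    (hker : RingHom.ker (aeval γ : O[X] →ₐ[O] B) = Ideal.span {X ^ p - C s}) (c : O) :
    Function.Surjective (aeval (γ - algebraMap O B c) : O[X] →ₐ[O] B) ∧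
      RingHom.ker (aeval (γ - algebraMap O B c) : O[X] →ₐ[O] B) = Ideal.span {X ^ p - C (s - c ^ p)} := by
  -- `aeval (γ - c) = aeval γ ∘ τ` with `τ : Y ↦ Y - c`
  set τ : O[X] ≃ₐ[O] O[X] := algEquivAevalXAddC (-c) with hτ
  have hcomp : (aeval (γ - algebraMap O B c) : O[X] →ₐ[O] B) = (aeval γ).comp τ.toAlgHom := by
    apply Polynomial.algHom_ext
    simp [hτ, sub_eq_add_neg]
  refine ⟨?_, ?_⟩
  · rw [hcomp]
    exact hsurj.comp τ.surjective
  · -- kernels: `g ∈ ker (aeval γ ∘ τ) ↔ τ g ∈ (Y^p - s) ↔ g ∈ (τ⁻¹ (Y^p - s))`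
    have hsymm : ∀ f : O[X], τ.symm f = aeval (X + C c) f := by
      intro f
      rw [hτ, algEquivAevalXAddC_symm, neg_neg, algEquivAevalXAddC_apply]
    have hf' : τ.symm (X ^ p - C s) = X ^ p - C (s - c ^ p) := by
      rw [hsymm]
      simp only [map_sub, map_pow, aeval_X, aeval_C, algebraMap_eq]
      rw [add_pow_char X (C c) p, ← C_pow]
      ring
    ext g
    rw [RingHom.mem_ker, hcomp, AlgHom.comp_apply, Ideal.mem_span_singleton]
    have h1 : (aeval γ : O[X] →ₐ[O] B) (τ.toAlgHom g) = 0 ↔ τ g ∈ RingHom.ker (aeval γ : O[X] →ₐ[O] B) := by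
      rw [RingHom.mem_ker]; rfl
    rw [h1, hker, Ideal.mem_span_singleton, ← hf']
    constructor
    · intro h
      have := map_dvd τ.symm h
      rwa [AlgEquiv.symm_apply_apply] at this
    · intro h
      have := map_dvd τ h
      rwa [AlgEquiv.apply_symm_apply] at this

end Presentation


/-! ## The cotangent count: a monogenic regular `B = O[y] ≅ O[Y]/(Y^p - s)` with `y ∈ 𝔪_B` has `s ∉ 𝔪_O²` -/

section Core

variable {O B : Type*} [CommRing O] [IsRegularLocalRing O] [CommRing B] [IsRegularLocalRing B] [Algebra O B]

/-- In the ideal `M = 𝔪_O O[Y] + (Y)` of `O[Y]`, constant coefficients lie in `𝔪_O`. [folklore] -/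
theorem coeff_zero_mem_of_mem_sup {U : O[X]}
    (hU : U ∈ (maximalIdeal O).map (C : O →+* O[X]) ⊔ Ideal.span {(X : O[X])}) :
    U.coeff 0 ∈ maximalIdeal O := by
  obtain ⟨U₁, hU₁, U₂, hU₂, rfl⟩ := Submodule.mem_sup.mp hU
  rw [coeff_add]
  refine Ideal.add_mem _ ((Ideal.mem_map_C_iff.mp hU₁) 0) ?_
  obtain ⟨r, rfl⟩ := Ideal.mem_span_singleton'.mp hU₂
  simp

/-- In `M²`, `M = 𝔪_O O[Y] + (Y)`, the constant coefficient lies in `𝔪_O²` and the `Y`-coefficient in `𝔪_O`.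
[folklore] -/
theorem coeff_mem_of_mem_sq {Q : O[X]}
    (hQ : Q ∈ ((maximalIdeal O).map (C : O →+* O[X]) ⊔ Ideal.span {(X : O[X])}) ^ 2) :
    Q.coeff 0 ∈ maximalIdeal O ^ 2 ∧ Q.coeff 1 ∈ maximalIdeal O := by
  rw [pow_two] at hQ
  refine Submodule.mul_induction_on hQ ?_ ?_
  · intro U hU V hV
    have hU0 := coeff_zero_mem_of_mem_sup hU
    have hV0 := coeff_zero_mem_of_mem_sup hV
    constructor
    · rw [mul_coeff_zero, pow_two]
      exact Ideal.mul_mem_mul hU0 hV0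
    · rw [coeff_mul, Finset.Nat.sum_antidiagonal_succ, Finset.Nat.antidiagonal_zero, Finset.sum_singleton]
      exact Ideal.add_mem _ (Ideal.mul_mem_right _ _ hU0) (Ideal.mul_mem_left _ _ hV0)
  · rintro U V ⟨hU0, hU1⟩ ⟨hV0, hV1⟩
    rw [coeff_add, coeff_add]
    exact ⟨Ideal.add_mem _ hU0 hV0, Ideal.add_mem _ hU1 hV1⟩

/-- **Cotangent count.** Let `O ⊆ B` be regular local rings, `B` finite over `O` along a local homomorphism, and
suppose `B = O[y] ≅ O[Y]/(Y^p - s)` via `Y ↦ y` with `y ∈ 𝔪_B`, `p ≥ 2`.  Then `s ∉ 𝔪_O²`: otherwise, lifting a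
`κ_O`-basis `x₁, …, x_d` of `𝔪_O/𝔪_O²` (`d = dim O = dim B`), the classes of `x₁, …, x_d, y` in `𝔪_B/𝔪_B²` are
linearly independent — a relation read in `O[Y]` lies in `(𝔪_O O[Y] + (Y))² + (Y^p - s)`, whose `Y⁰`-coefficients are
in `𝔪_O²` and `Y¹`-coefficients in `𝔪_O` — contradicting `dim_{κ_B} 𝔪_B/𝔪_B² = dim B = d`. [folklore] -/
theorem not_mem_sq_of_presentation [Module.Finite O B] [IsLocalHom (algebraMap O B)]
    (hinj : Function.Injective (algebraMap O B)) {p : ℕ} (hp : p.Prime)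
    (y : B) (s : O) (hy : y ∈ maximalIdeal B)
    (hsurj : Function.Surjective (aeval y : O[X] →ₐ[O] B))
    (hker : RingHom.ker (aeval y : O[X] →ₐ[O] B) = Ideal.span {X ^ p - C s}) :
    s ∉ maximalIdeal O ^ 2 := by
  classical
  intro hs2
  have hs : s ∈ maximalIdeal O := Ideal.pow_le_self two_ne_zero hs2
  set φ : O[X] →ₐ[O] B := aeval y with hφ
  set f : O[X] := X ^ p - C s with hf
  set M : Ideal O[X] := (maximalIdeal O).map (C : O →+* O[X]) ⊔ Ideal.span {(X : O[X])} with hM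
  -- local homomorphism bookkeeping
  have hmO : ∀ a : O, a ∈ maximalIdeal O ↔ algebraMap O B a ∈ maximalIdeal B := by
    intro a
    rw [IsLocalRing.mem_maximalIdeal, IsLocalRing.mem_maximalIdeal]
    exact (map_mem_nonunits_iff (algebraMap O B) a).symm
  -- every element of `B` is `φ A`; it lies in `𝔪_B` iff `A.coeff 0 ∈ 𝔪_O`
  have hφC : ∀ a : O, φ (C a) = algebraMap O B a := fun a => by rw [hφ, aeval_C]
  have hφX : φ X = y := by rw [hφ, aeval_X]
  have hdecomp : ∀ A : O[X], φ A = y * φ (divX A) + algebraMap O B (A.coeff 0) := by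
    intro A
    conv_lhs => rw [← X_mul_divX_add A]
    rw [map_add, map_mul, hφX, hφC]
  have hmemB : ∀ A : O[X], A.coeff 0 ∈ maximalIdeal O → φ A ∈ maximalIdeal B := by
    intro A hA
    rw [hdecomp]
    exact Ideal.add_mem _ (Ideal.mul_mem_right _ _ hy) ((hmO _).mp hA)
  -- `𝔪_B ≤ M.map φ`
  have hmB : maximalIdeal B ≤ M.map φ := by
    intro b hb
    obtain ⟨A, rfl⟩ := hsurj b
    have hA0 : A.coeff 0 ∈ maximalIdeal O := by
      rw [hmO]
      have : algebraMap O B (A.coeff 0) = φ A - y * φ (divX A) := by rw [hdecomp]; ring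
      rw [this]
      exact Ideal.sub_mem _ hb (Ideal.mul_mem_right _ _ hy)
    have : A = C (A.coeff 0) + X * divX A := by rw [add_comm, X_mul_divX_add]
    rw [this, map_add]
    refine Ideal.add_mem _ (Ideal.mem_map_of_mem _ ?_) (Ideal.mem_map_of_mem _ ?_)
    · exact Ideal.mem_sup_left (Ideal.mem_map_of_mem _ hA0)
    · exact Ideal.mem_sup_right (Ideal.mul_mem_right _ _ (Ideal.mem_span_singleton_self _))
  -- coefficients of multiples of `f`
  have hf0 : f.coeff 0 = -s := by
    rw [hf, coeff_sub, coeff_X_pow, coeff_C_zero, if_neg hp.ne_zero.symm, zero_sub]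
  have hf1 : f.coeff 1 = 0 := by
    rw [hf, coeff_sub, coeff_X_pow, coeff_C, if_neg hp.one_lt.ne, if_neg one_ne_zero, sub_zero]
  have hqf : ∀ q : O[X], (q * f).coeff 0 ∈ maximalIdeal O ^ 2 ∧ (q * f).coeff 1 ∈ maximalIdeal O := by
    intro q
    constructor
    · rw [mul_coeff_zero, hf0, mul_neg]
      exact neg_mem_iff.mpr (Ideal.mul_mem_left _ _ hs2)
    · rw [coeff_mul, Finset.Nat.sum_antidiagonal_succ, Finset.Nat.antidiagonal_zero, Finset.sum_singleton, hf0, hf1,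
        mul_zero, zero_add, mul_neg]
      exact neg_mem_iff.mpr (Ideal.mul_mem_left _ _ hs)
  -- dimensions: `d = dim O = dim B`
  haveI : Algebra.IsIntegral O B := Algebra.IsIntegral.of_finite O B
  set d : ℕ := Module.finrank (ResidueField O) (CotangentSpace O) with hd
  have hdO : (d : WithBot ℕ∞) = ringKrullDim O := (IsRegularLocalRing.iff_finrank_cotangentSpace O).mp ‹_›
  have hdimB : ringKrullDim B = ringKrullDim O :=
    Literature.AlgebraicGeometry.Resolution.ringKrullDim_eq_of_isIntegral hinj
  have hdB : Module.finrank (ResidueField B) (CotangentSpace B) = d := by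
    have h := (IsRegularLocalRing.iff_finrank_cotangentSpace B).mp ‹_›
    rw [hdimB, ← hdO] at h
    exact_mod_cast h
  -- a `κ_O`-basis of `𝔪_O/𝔪_O²`, lifted to `𝔪_O`
  set bO := Module.finBasis (ResidueField O) (CotangentSpace O) with hbO
  have hlift : ∀ i : Fin d, ∃ x : maximalIdeal O, (maximalIdeal O).toCotangent x = bO i :=
    fun i => Ideal.toCotangent_surjective _ _
  choose x hx using hlift
  -- the `d + 1` elements `x₁, …, x_d, y` of `𝔪_B` (as `w : Option (Fin d) → 𝔪_B`) and their polynomial names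
  let w : Option (Fin d) → maximalIdeal B := fun o =>
    o.elim ⟨y, hy⟩ (fun i => ⟨algebraMap O B (x i), (hmO _).mp (x i).2⟩)
  let W : Option (Fin d) → O[X] := fun o => o.elim X (fun i => C ((x i : O)))
  have hφW : ∀ o, φ (W o) = (w o : B) := by
    rintro (_ | i)
    · exact hφX
    · exact hφC _
  -- CLAIM: the classes of `w` in `𝔪_B/𝔪_B²` are linearly independent over `κ_B`
  have hli : LinearIndependent (ResidueField B) (fun o => (maximalIdeal B).toCotangent (w o)) := by
    rw [Fintype.linearIndependent_iff]
    intro g hg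
    -- lift the coefficients to `B` and then to `O[X]`
    have hlg : ∀ o, ∃ a : B, residue B a = g o := fun o => Ideal.Quotient.mk_surjective (g o)
    choose a ha using hlg
    have hlA : ∀ o, ∃ A : O[X], φ A = a o := fun o => hsurj (a o)
    choose A hA using hlA
    -- the relation: `∑ a o • w o ∈ 𝔪_B²`
    have hrel : (∑ o, a o * (w o : B)) ∈ maximalIdeal B ^ 2 := by
      have h1 : (maximalIdeal B).toCotangent (∑ o, a o • w o) = 0 := by
        rw [map_sum]
        rw [← hg]
        refine Finset.sum_congr rfl fun o _ => ?_
        rw [map_smul, ← ha o, ← IsLocalRing.ResidueField.algebraMap_eq, algebraMap_smul]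
      rw [Ideal.toCotangent_eq_zero] at h1
      simpa only [Submodule.coe_sum, Submodule.coe_smul, smul_eq_mul] using h1
    -- read it in `O[X]`: `P := ∑ A o * W o` maps to the relation, so `P ∈ M² + (f)`
    set P : O[X] := ∑ o, A o * W o with hP
    have hφP : φ P = ∑ o, a o * (w o : B) := by
      rw [hP, map_sum]
      exact Finset.sum_congr rfl fun o _ => by rw [map_mul, hA, hφW]
    have hPmem : ∑ o, a o * (w o : B) ∈ (M ^ 2).map φ := by
      rw [Ideal.map_pow]
      exact Ideal.pow_right_mono hmB 2 hrel
    obtain ⟨Z, hZ, hZP⟩ := (Ideal.mem_map_iff_of_surjective φ hsurj).mp hPmem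
    have hPZ : P - Z ∈ RingHom.ker φ := by
      rw [RingHom.mem_ker, map_sub, hφP, hZP, sub_self]
    rw [hker, Ideal.mem_span_singleton'] at hPZ
    obtain ⟨q, hq⟩ := hPZ
    have hPeq : P = Z + q * f := by rw [hq]; ring
    obtain ⟨hZ0, hZ1⟩ := coeff_mem_of_mem_sq hZ
    obtain ⟨hq0, hq1⟩ := hqf q
    -- coefficient `Y⁰`: `∑ i, (A i)₀ x_i ∈ 𝔪_O²`
    have hP0 : P.coeff 0 = ∑ i : Fin d, (A (some i)).coeff 0 * (x i : O) := by
      rw [hP, finsetSum_coeff, Fintype.sum_option]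
      simp only [W, Option.elim, mul_coeff_zero, coeff_X_zero, mul_zero, zero_add, coeff_C_zero]
    have hP1 : P.coeff 1 = (A none).coeff 0 + ∑ i : Fin d, (A (some i)).coeff 1 * (x i : O) := by
      rw [hP, finsetSum_coeff, Fintype.sum_option]
      simp only [W, Option.elim, coeff_mul_X, coeff_mul_C]
    have hsum0 : ∑ i : Fin d, (A (some i)).coeff 0 * (x i : O) ∈ maximalIdeal O ^ 2 := by
      rw [← hP0, hPeq, coeff_add]
      exact Ideal.add_mem _ hZ0 hq0
    -- hence every `(A (some i)).coeff 0 ∈ 𝔪_O` (the `x̄_i` form a basis of `𝔪_O/𝔪_O²`)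
    have hAi : ∀ i : Fin d, (A (some i)).coeff 0 ∈ maximalIdeal O := by
      have hcot : (maximalIdeal O).toCotangent
          (∑ i : Fin d, (A (some i)).coeff 0 • x i) = 0 := by
        rw [Ideal.toCotangent_eq_zero]
        simpa only [Submodule.coe_sum, Submodule.coe_smul, smul_eq_mul] using hsum0
      rw [map_sum] at hcot
      have hcot' : ∑ i : Fin d, residue O ((A (some i)).coeff 0) • bO i = 0 := by
        rw [← hcot]
        refine Finset.sum_congr rfl fun i _ => ?_
        rw [map_smul, hx, ← IsLocalRing.ResidueField.algebraMap_eq, algebraMap_smul]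
      intro i
      have := Fintype.linearIndependent_iff.mp bO.linearIndependent _ hcot' i
      exact (IsLocalRing.residue_eq_zero_iff _).mp this
    -- coefficient `Y¹`: `(A none)₀ ∈ 𝔪_O`
    have hAnone : (A none).coeff 0 ∈ maximalIdeal O := by
      have h1 : P.coeff 1 ∈ maximalIdeal O := by
        rw [hPeq, coeff_add]
        exact Ideal.add_mem _ hZ1 hq1
      rw [hP1] at h1
      have h2 : ∑ i : Fin d, (A (some i)).coeff 1 * (x i : O) ∈ maximalIdeal O :=
        Ideal.sum_mem _ fun i _ => Ideal.mul_mem_left _ _ (x i).2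
      simpa using Ideal.sub_mem _ h1 h2
    -- so every coefficient `a o = φ (A o)` lies in `𝔪_B`, i.e. `g o = 0`
    intro o
    rw [← ha o, IsLocalRing.residue_eq_zero_iff, ← hA o]
    refine hmemB _ ?_
    rcases o with _ | i
    · exact hAnone
    · exact hAi i
  -- `d + 1 ≤ d`: contradiction
  have hcard := hli.fintype_card_le_finrank
  rw [Fintype.card_option, Fintype.card_fin, hdB] at hcard
  omega

end Core

end Summit.ResolutionOfSingularities.ResolutionOfSingularities.Theorems.RadicialJung.CleanModels

end
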